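import Literature.NumberTheory.EllipticCurves.EisensteinDedekindMeasureTwo
import Literature.ComputerArithmetic.BrentZimmermann2010.ExtendedGcdCofactorBound
import HarnessLib

/-!
# The Bézout coefficient modulo `2^m` is the centred inverse, and the centred inverse over `2^m` is a
# difference of two Bernoulli sawtooth values (PROOFS ONLY)

Theorem-only file. For an odd `x` and `M = 2^m`, Mathlib's Bézout coefficient `y = Nat.gcdB M x = Int.gcdB M x`
(`M·gcdA + x·gcdB = gcd = 1`) is the representative of `x⁻¹ (mod M)` in the CENTRED window `(−M/2, M/2]`
(Brent–Zimmermann Exercise 1.30, vendored as `ExtendedGcdCofactorBound.gcdB_bound`: `−M < 2·gcd·gcdB ≤ M`), and the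
centred representative `c(r)` of an odd residue `r (mod 2^{m+2})` satisfies the two-level sawtooth identity
`c(r)/2^{m+2} = B₁(⟨r/2^{m+1}⟩) − B₁(⟨r/2^{m+2}⟩)` (`B₁(t) = t − ½`; both cases `r < 2^{m+1}`, `r > 2^{m+1}` by
inspection). Consequently the "Bézout junk" `N·y_A/2^m`, `y_A = gcdB(2^m, AN)`, in the cusp values of the
C-normalised Eisenstein measure at `2` (cell bsd-rank2, line `star`, `eisJunk`) is, on the nose,
`N·(E₁^{(2^{m−1})}((AN)⁻¹) − E₁^{(2^m)}((AN)⁻¹))` — a level difference of the `E₁`-distribution composed with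
`A ↦ (AN)⁻¹`, i.e. of `χ₋₄(AN)·[N]^*((χ₋₄E₁)ˇ)` in the tree's vocabulary (`bernoulliDist 1`, `invUnitsDist`,
`codilate`, `klTwoDistribution`; §3), with NO rounding indicator.

References: R. Brent, P. Zimmermann, Modern Computer Arithmetic (2010), §1.6.2–§1.8, Exercise 1.30 [BrentZimmermann2010];
S. Lang, Cyclotomic Fields I and II, GTM 121 (1990), Ch. 2 §2 (E₁, B 4), Ch. 4 §2 (operations on measures)
[LangCyclotomic1990]; G. Stevens, Arithmetic on Modular Curves (1982), §5.2, §5.4 [Stevens1982].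
-/

noncomputable section

open scoped Classical

namespace Literature.NumberTheory.EllipticCurves

open Literature.ComputerArithmetic.BrentZimmermann2010

/-! ## 1. `gcdB(2^m, x)` is the centred inverse of an odd `x` -/

/-- Mathlib's integer and natural Bézout coefficients agree on naturals (definitional).
[cite: BrentZimmermann2010, §1.6.2 (ExtendedGcd)] -/
theorem int_gcdB_natCast (a b : ℕ) : Int.gcdB (a : ℤ) (b : ℤ) = Nat.gcdB a b := rfl

/-- **`x · gcdB(M, x) ≡ 1 (mod M)`** for `x` prime to `M` (Bézout: `M·gcdA + x·gcdB = gcd(M, x) = 1`).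
[cite: BrentZimmermann2010, §1.6.2 (ExtendedGcd, Bézout relation)] -/
theorem natCast_mul_gcdB_eq_one {M x : ℕ} (h : Nat.Coprime M x) :
    ((x : ℤ) : ZMod M) * ((Nat.gcdB M x : ℤ) : ZMod M) = 1 := by
  have hb := Nat.gcd_eq_gcd_ab M x
  rw [Nat.Coprime.gcd_eq_one h, Nat.cast_one] at hb
  have h0 : ((M : ℤ) : ZMod M) = 0 := by simp
  have := congr_arg (fun z : ℤ ↦ (z : ZMod M)) hb
  simp only [Int.cast_one, Int.cast_add, Int.cast_mul, h0, zero_mul, zero_add] at this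
  exact this.symm

/-- **The Bézout coefficient is the inverse**: `(x : ℤ/M)⁻¹ = gcdB(M, x)` for `x` prime to `M`.
[cite: BrentZimmermann2010, §1.6.2 (ExtendedGcd computes the modular inverse)] -/
theorem inv_natCast_eq_gcdB {M x : ℕ} (h : Nat.Coprime M x) :
    ((x : ZMod M))⁻¹ = ((Nat.gcdB M x : ℤ) : ZMod M) := by
  refine ZMod.inv_eq_of_mul_eq_one _ _ _ ?_
  have := natCast_mul_gcdB_eq_one h
  rwa [Int.cast_natCast] at this

/-- **The centred window**: for odd `x`, `−2^{m+1} < gcdB(2^{m+2}, x) < 2^{m+1}` (Exercise 1.30 gives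
`−2^{m+2} < 2·gcdB ≤ 2^{m+2}`, and `gcdB` is odd, being an inverse of the odd `x` modulo `2^{m+2}`).
[cite: BrentZimmermann2010, §1.8 Exercise 1.30] -/
theorem gcdB_two_pow_mem_window (m : ℕ) {x : ℕ} (hx : Odd x) :
    -(2 : ℤ) ^ (m + 1) < Nat.gcdB (2 ^ (m + 2)) x ∧ Nat.gcdB (2 ^ (m + 2)) x < (2 : ℤ) ^ (m + 1) ∧
      Odd (Nat.gcdB (2 ^ (m + 2)) x) := by
  have hcop : Nat.Coprime (2 ^ (m + 2)) x := Nat.Coprime.pow_left _ (Nat.coprime_two_left.mpr hx)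
  have hb := ExtendedGcdCofactorBound.gcdB_bound (a := x) (b := 2 ^ (m + 2)) (by positivity)
  rw [Nat.gcd_comm, Nat.Coprime.gcd_eq_one hcop] at hb
  push_cast at hb
  -- oddness from the Bézout relation `2^{m+2}·gcdA + x·gcdB = 1`
  have hodd : Odd (Nat.gcdB (2 ^ (m + 2)) x) := by
    have hbz := Nat.gcd_eq_gcd_ab (2 ^ (m + 2)) x
    rw [Nat.Coprime.gcd_eq_one hcop, Nat.cast_one] at hbz
    have hx' : Odd (x : ℤ) := by exact_mod_cast hx
    have h2 : Even ((2 ^ (m + 2) : ℕ) * Nat.gcdA (2 ^ (m + 2)) x : ℤ) := by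
      push_cast
      exact (Int.even_pow.mpr ⟨even_two, by omega⟩).mul_right _
    have h1 : Odd ((x : ℤ) * Nat.gcdB (2 ^ (m + 2)) x) := by
      have : (x : ℤ) * Nat.gcdB (2 ^ (m + 2)) x = 1 - (2 ^ (m + 2) : ℕ) * Nat.gcdA (2 ^ (m + 2)) x := by
        linarith
      rw [this]
      exact odd_one.sub_even h2
    exact (Int.odd_mul.mp h1).2
  refine ⟨?_, ?_, hodd⟩
  · have : (2 : ℤ) ^ (m + 2) = 2 * 2 ^ (m + 1) := by ring
    linarith [hb.1]
  · have h2 : (2 : ℤ) ^ (m + 2) = 2 * 2 ^ (m + 1) := by ring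
    rcases hb.2.lt_or_eq with hlt | heq
    · linarith
    · exfalso
      have : Nat.gcdB (2 ^ (m + 2)) x = 2 ^ (m + 1) := by linarith
      rw [this] at hodd
      exact (Int.not_even_iff_odd.mpr hodd) (Int.even_pow.mpr ⟨even_two, by omega⟩)

/-! ## 2. The centred inverse over `2^m` is a difference of two sawtooth values -/

/-- `E₁^{(M)}(b) = b.val/M − ½` (`B₁(X) = X − ½`). [cite: LangCyclotomic1990, Ch. 2 §2, B 4 (PDF p. 34)] -/
theorem bernoulliDist_one_apply (M : ℕ) (b : ZMod M) :
    bernoulliDist 1 M b = (b.val : ℚ) / M - 1 / 2 := by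
  rw [bernoulliDist, Polynomial.bernoulli_one]
  simp

/-- The value of an integer representative: `E₁^{(M)}(y mod M) = (y % M)/M − ½`.
[cite: LangCyclotomic1990, Ch. 2 §2, B 4 (PDF p. 34)] -/
theorem bernoulliDist_one_intCast (M : ℕ) [NeZero M] (y : ℤ) :
    bernoulliDist 1 M (y : ZMod M) = ((y % (M : ℤ) : ℤ) : ℚ) / M - 1 / 2 := by
  rw [bernoulliDist_one_apply, ← ZMod.val_intCast y, Int.cast_natCast]

/-- **Two-level sawtooth identity for a centred odd residue.** For an integer `y` with `−2^{m+1} < y < 2^{m+1}`: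
`y/2^{m+2} = E₁^{(2^{m+1})}(y) − E₁^{(2^{m+2})}(y)` (for `y ≥ 0` both residues are `y`; for `y < 0` they are
`y + 2^{m+1}` and `y + 2^{m+2}`). [cite: LangCyclotomic1990, Ch. 2 §2, B 4 (PDF p. 34)] -/
theorem div_two_pow_eq_bernoulliDist_sub {m : ℕ} {y : ℤ} (hlo : -(2 : ℤ) ^ (m + 1) < y) (hhi : y < (2 : ℤ) ^ (m + 1)) :
    (y : ℚ) / (2 ^ (m + 2) : ℕ) =
      bernoulliDist 1 (2 ^ (m + 1)) (y : ZMod (2 ^ (m + 1))) - bernoulliDist 1 (2 ^ (m + 2)) (y : ZMod (2 ^ (m + 2))) := by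
  haveI : NeZero (2 ^ (m + 1)) := ⟨pow_ne_zero _ two_ne_zero⟩
  haveI : NeZero (2 ^ (m + 2)) := ⟨pow_ne_zero _ two_ne_zero⟩
  rw [bernoulliDist_one_intCast, bernoulliDist_one_intCast]
  have h2 : (2 : ℤ) ^ (m + 2) = 2 * 2 ^ (m + 1) := by ring
  rcases le_or_gt 0 y with hy | hy
  · have e1 : y % ((2 ^ (m + 1) : ℕ) : ℤ) = y := by
      push_cast
      exact Int.emod_eq_of_lt hy hhi
    have e2 : y % ((2 ^ (m + 2) : ℕ) : ℤ) = y := by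
      push_cast
      exact Int.emod_eq_of_lt hy (by linarith)
    rw [e1, e2]
    push_cast
    ring
  · have e1 : y % ((2 ^ (m + 1) : ℕ) : ℤ) = y + 2 ^ (m + 1) := by
      push_cast
      rw [← Int.add_mul_emod_self_right y 1 ((2 : ℤ) ^ (m + 1)), one_mul]
      exact Int.emod_eq_of_lt (by linarith) (by linarith)
    have e2 : y % ((2 ^ (m + 2) : ℕ) : ℤ) = y + 2 ^ (m + 2) := by
      push_cast
      rw [← Int.add_mul_emod_self_right y 1 ((2 : ℤ) ^ (m + 2)), one_mul]
      exact Int.emod_eq_of_lt (by linarith) (by linarith)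
    rw [e1, e2]
    push_cast
    ring

/-- **`gcdB(2^{m+2}, x)/2^{m+2} = E₁^{(2^{m+1})}(x⁻¹) − E₁^{(2^{m+2})}(x⁻¹)`** for odd `x`: the Bézout junk is an exact
level difference of the sawtooth distribution at the inverse class (no rounding term).
[cite: BrentZimmermann2010, §1.8 Exercise 1.30] [cite: LangCyclotomic1990, Ch. 2 §2, B 4 (PDF p. 34)] -/
theorem gcdB_two_pow_div_eq_bernoulliDist_sub (m : ℕ) {x : ℕ} (hx : Odd x) :
    ((Nat.gcdB (2 ^ (m + 2)) x : ℤ) : ℚ) / (2 ^ (m + 2) : ℕ) =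
      bernoulliDist 1 (2 ^ (m + 1)) ((x : ZMod (2 ^ (m + 1))))⁻¹ -
        bernoulliDist 1 (2 ^ (m + 2)) ((x : ZMod (2 ^ (m + 2))))⁻¹ := by
  obtain ⟨hlo, hhi, -⟩ := gcdB_two_pow_mem_window m hx
  have hcop2 : Nat.Coprime (2 ^ (m + 2)) x := Nat.Coprime.pow_left _ (Nat.coprime_two_left.mpr hx)
  have hcop1 : Nat.Coprime (2 ^ (m + 1)) x := Nat.Coprime.pow_left _ (Nat.coprime_two_left.mpr hx)
  rw [div_two_pow_eq_bernoulliDist_sub hlo hhi, inv_natCast_eq_gcdB hcop2, inv_natCast_eq_gcdB hcop1]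
  -- the level-`2^{m+1}` inverse is the reduction of the level-`2^{m+2}` Bézout coefficient
  congr 2
  have h1 := natCast_mul_gcdB_eq_one hcop1
  have h2 : ((x : ℤ) : ZMod (2 ^ (m + 1))) * ((Nat.gcdB (2 ^ (m + 2)) x : ℤ) : ZMod (2 ^ (m + 1))) = 1 := by
    have h := natCast_mul_gcdB_eq_one hcop2
    have hc := congr_arg (ZMod.castHom (pow_dvd_pow 2 (m + 1).le_succ) (ZMod (2 ^ (m + 1)))) h
    rwa [map_mul, map_one, map_intCast, map_intCast] at hc
  -- both are inverses of the unit `x` modulo `2^{m+1}`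
  calc ((Nat.gcdB (2 ^ (m + 2)) x : ℤ) : ZMod (2 ^ (m + 1)))
      = ((x : ℤ) : ZMod (2 ^ (m + 1)))⁻¹ := (ZMod.inv_eq_of_mul_eq_one _ _ _ h2).symm
    _ = ((Nat.gcdB (2 ^ (m + 1)) x : ℤ) : ZMod (2 ^ (m + 1))) := ZMod.inv_eq_of_mul_eq_one _ _ _ h1

/-- The same with Mathlib's INTEGER Bézout coefficient `Int.gcdB (2^{m+2}) x` (the shape used Summit-side).
[cite: BrentZimmermann2010, §1.8 Exercise 1.30] [cite: LangCyclotomic1990, Ch. 2 §2, B 4 (PDF p. 34)] -/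
theorem int_gcdB_two_pow_div_eq_bernoulliDist_sub (m : ℕ) {x : ℕ} (hx : Odd x) :
    ((Int.gcdB ((2 ^ (m + 2) : ℕ) : ℤ) (x : ℤ) : ℤ) : ℚ) / (2 ^ (m + 2) : ℕ) =
      bernoulliDist 1 (2 ^ (m + 1)) ((x : ZMod (2 ^ (m + 1))))⁻¹ -
        bernoulliDist 1 (2 ^ (m + 2)) ((x : ZMod (2 ^ (m + 2))))⁻¹ := by
  rw [int_gcdB_natCast]
  exact gcdB_two_pow_div_eq_bernoulliDist_sub m hx

/-- The inverse modulo `2^{m+1}` of an odd `x` is the reduction of its inverse modulo `2^{m+2}`; in terms of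
representatives, `((x : ℤ/2^{m+1})⁻¹) = ((x⁻¹ mod 2^{m+2}).val mod 2^{m+1})` — the `Ā = A mod 2^{m−1}` bookkeeping.
[cite: LangCyclotomic1990, Ch. 2 §2 (distribution relation, PDF p. 34)] -/
theorem inv_natCast_eq_castHom_inv (m : ℕ) {x : ℕ} (hx : Odd x) :
    ((x : ZMod (2 ^ (m + 1))))⁻¹ =
      ZMod.castHom (pow_dvd_pow 2 (m + 1).le_succ) (ZMod (2 ^ (m + 1))) (((x : ZMod (2 ^ (m + 2))))⁻¹) := by
  have hcop2 : Nat.Coprime (2 ^ (m + 2)) x := Nat.Coprime.pow_left _ (Nat.coprime_two_left.mpr hx)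
  have hcop1 : Nat.Coprime (2 ^ (m + 1)) x := Nat.Coprime.pow_left _ (Nat.coprime_two_left.mpr hx)
  refine ZMod.inv_eq_of_mul_eq_one _ _ _ ?_
  have h := ZMod.coe_mul_inv_eq_one x hcop2.symm
  have hc := congr_arg (ZMod.castHom (pow_dvd_pow 2 (m + 1).le_succ) (ZMod (2 ^ (m + 1)))) h
  rwa [map_mul, map_one, map_natCast] at hc

/-- The reduction `r mod 2^m` of a level-`2^{m+1}` class has representative `r.val mod 2^m`.
[cite: LangCyclotomic1990, Ch. 2 §2 (distribution relation, PDF p. 34)] -/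
theorem val_castHom_two_pow (m : ℕ) (r : ZMod (2 ^ (m + 1))) :
    (ZMod.castHom (pow_dvd_pow 2 m.le_succ) (ZMod (2 ^ m)) r).val = r.val % 2 ^ m := by
  haveI : NeZero (2 ^ (m + 1)) := ⟨pow_ne_zero _ two_ne_zero⟩
  rw [ZMod.castHom_apply, ZMod.cast_eq_val, ZMod.val_natCast]

/-- **The pull-back (Hecke) defect of the sawtooth is `± ½`**: for a class `r` modulo `2^{m+1}` with reduction `r̄`
modulo `2^m`, `2·E₁^{(2^{m+1})}(r) − E₁^{(2^m)}(r̄) = ε − ½` with `ε = 1` if `r.val ≥ 2^m` and `ε = 0` otherwise. (So the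
level-tower defect of the Bézout junk `c·(b_m − π^*b_{m−1})`, `b = E₁ ∘ (A ↦ (AN)⁻¹)`, is `c·(±½)`: divisible by `8` in `ℤ₂` as
soon as `16 ∣ c`.) [cite: LangCyclotomic1990, Ch. 2 §2, B 4 and the distribution relation (PDF p. 34)] -/
theorem two_mul_bernoulliDist_one_sub_castHom (m : ℕ) (r : ZMod (2 ^ (m + 1))) :
    2 * bernoulliDist 1 (2 ^ (m + 1)) r - bernoulliDist 1 (2 ^ m) (ZMod.castHom (pow_dvd_pow 2 m.le_succ) (ZMod (2 ^ m)) r) =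
      (if 2 ^ m ≤ r.val then 1 else 0) - 1 / 2 := by
  haveI : NeZero (2 ^ (m + 1)) := ⟨pow_ne_zero _ two_ne_zero⟩
  rw [bernoulliDist_one_apply, bernoulliDist_one_apply, val_castHom_two_pow]
  have hlt : r.val < 2 ^ (m + 1) := ZMod.val_lt r
  have hpow : (2 : ℕ) ^ (m + 1) = 2 * 2 ^ m := by ring
  have hpos : (0 : ℚ) < 2 ^ m := by positivity
  split_ifs with h
  · -- `r.val = 2^m + (r.val % 2^m)`
    have hmod : r.val % 2 ^ m = r.val - 2 ^ m := by
      rw [Nat.mod_eq_sub_mod h, Nat.mod_eq_of_lt (by omega)]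
    rw [hmod, Nat.cast_sub h]
    push_cast
    field_simp
    ring
  · have hmod : r.val % 2 ^ m = r.val := Nat.mod_eq_of_lt (by omega)
    rw [hmod]
    push_cast
    field_simp
    ring

/-- The defect in absolute value: `|2·E₁^{(2^{m+1})}(r) − E₁^{(2^m)}(r̄)| = ½`, whence for a coefficient `c ∈ ℚ` with
`‖c‖₂ ≤ 16⁻¹` the `2`-adic bound `‖c·(2E₁^{(2^{m+1})}(r) − E₁^{(2^m)}(r̄))‖₂ ≤ 8⁻¹` (the mod-8 tower hypothesis of
`norm_le_eighth_of_stevensSmoothing` for the Bézout-junk part). [cite: LangCyclotomic1990, Ch. 2 §2, B 4 (PDF p. 34)] -/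
theorem norm_mul_two_mul_bernoulliDist_one_sub_castHom_le (m : ℕ) (r : ZMod (2 ^ (m + 1))) {c : ℚ}
    (hc : ‖((c : ℚ) : ℚ_[2])‖ ≤ 16⁻¹) :
    ‖((c * (2 * bernoulliDist 1 (2 ^ (m + 1)) r -
        bernoulliDist 1 (2 ^ m) (ZMod.castHom (pow_dvd_pow 2 m.le_succ) (ZMod (2 ^ m)) r)) : ℚ) : ℚ_[2])‖ ≤ 8⁻¹ := by
  rw [two_mul_bernoulliDist_one_sub_castHom]
  have h2 : ‖(2 : ℚ_[2])‖ = 2⁻¹ := by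
    have := Padic.norm_p (p := 2)
    simp only [Nat.cast_ofNat] at this
    exact this
  have hhalf : ∀ s : ℚ, (s = 1 ∨ s = 0) → ‖(((s - 1 / 2 : ℚ)) : ℚ_[2])‖ = 2 := by
    intro s hs
    have hinv : ‖(((1 / 2 : ℚ)) : ℚ_[2])‖ = 2 := by
      push_cast
      rw [norm_div, norm_one, h2]
      norm_num
    rcases hs with rfl | rfl
    · rw [show ((1 : ℚ) - 1 / 2) = 1 / 2 by norm_num, hinv]
    · rw [zero_sub, Rat.cast_neg, norm_neg, hinv]
  have hs : ((if 2 ^ m ≤ r.val then (1 : ℚ) else 0) = 1 ∨ (if 2 ^ m ≤ r.val then (1 : ℚ) else 0) = 0) := by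
    split_ifs <;> simp
  rw [Rat.cast_mul, norm_mul, hhalf _ hs]
  calc ‖((c : ℚ) : ℚ_[2])‖ * 2 ≤ 16⁻¹ * 2 := by gcongr
    _ = 8⁻¹ := by norm_num

/-! ## 3. Dictionary with the tree's `χ₋₄E₁` objects -/

/-- `χ₋₄(x)² = 1` for odd `x`. [cite: LangCyclotomic1990, Ch. 2 §2 (characters on Z(m)^*, PDF p. 36)] -/
theorem chiMinusFour_mul_self_of_odd {p : ℕ} [Fact p.Prime] {x : ℕ} (hx : Odd x) :
    (chiMinusFour p x) * (chiMinusFour p x) = 1 := by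
  rw [chiMinusFour_eq_ite]
  have : x % 4 = 1 ∨ x % 4 = 3 := by rcases hx with ⟨k, rfl⟩; omega
  rcases this with h | h <;> simp [h]

/-- `χ₋₄(x⁻¹ mod 2^m) = χ₋₄(x)` for odd `x` and `m ≥ 2` (`x·x⁻¹ ≡ 1 (mod 4)`).
[cite: LangCyclotomic1990, Ch. 2 §2 (characters on Z(m)^*, PDF p. 36)] -/
theorem chiMinusFour_inv_val {p : ℕ} [Fact p.Prime] {m : ℕ} (hm : 2 ≤ m) {x : ℕ} (hx : Odd x) :
    chiMinusFour p (((x : ZMod (2 ^ m)))⁻¹).val = chiMinusFour p x := by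
  haveI : NeZero (2 ^ m) := ⟨pow_ne_zero _ two_ne_zero⟩
  have hcop : Nat.Coprime x (2 ^ m) := (Nat.Coprime.pow_left _ (Nat.coprime_two_left.mpr hx)).symm
  have h4 : 4 ∣ 2 ^ m := by
    obtain ⟨k, rfl⟩ := Nat.exists_eq_add_of_le hm
    exact ⟨2 ^ k, by ring⟩
  -- `x · (x⁻¹).val ≡ 1 (mod 4)`
  have hmod : (x * (((x : ZMod (2 ^ m)))⁻¹).val) % 4 = 1 := by
    have h1 : ((x * (((x : ZMod (2 ^ m)))⁻¹).val : ℕ) : ZMod (2 ^ m)) = 1 := by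
      push_cast
      rw [ZMod.natCast_zmod_val]
      exact ZMod.coe_mul_inv_eq_one x hcop
    have h2 : (x * (((x : ZMod (2 ^ m)))⁻¹).val) % 2 ^ m = 1 % 2 ^ m := by
      rw [← ZMod.natCast_eq_natCast_iff', h1, Nat.cast_one]
    have h3 : 1 % 2 ^ m = 1 := Nat.mod_eq_of_lt (Nat.one_lt_two_pow (by omega))
    rw [h3] at h2
    have := Nat.mod_mod_of_dvd (x * (((x : ZMod (2 ^ m)))⁻¹).val) h4
    rw [← this, h2]
  have hprod : chiMinusFour p x * chiMinusFour p (((x : ZMod (2 ^ m)))⁻¹).val = 1 := by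
    rw [← chiMinusFour_mul, chiMinusFour_eq_ite, if_pos hmod]
  calc chiMinusFour p (((x : ZMod (2 ^ m)))⁻¹).val
      = chiMinusFour p x * chiMinusFour p x * chiMinusFour p (((x : ZMod (2 ^ m)))⁻¹).val := by
        rw [chiMinusFour_mul_self_of_odd hx, one_mul]
    _ = chiMinusFour p x := by rw [mul_assoc, hprod, mul_one]

/-- **`E₁^{(2^m)}(x⁻¹) = χ₋₄(x) · (χ₋₄E₁)ˇ(x + 2^mℤ₂)`** for odd `x`, `m ≥ 2`: the sawtooth at the inverse class is
the `χ₋₄`-twist of the tree's inverted distribution `invUnitsDist klTwoDistribution`.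
[cite: LangCyclotomic1990, Ch. 2 §2, B 4 (PDF p. 34) and Ch. 4 §2 (operations on measures, PDF pp. 80–82)] -/
theorem bernoulliDist_inv_eq_chiMinusFour_mul_invUnitsDist {m : ℕ} (hm : 2 ≤ m) {x : ℕ} (hx : Odd x) :
    ((bernoulliDist 1 (2 ^ m) ((x : ZMod (2 ^ m)))⁻¹ : ℚ) : ℚ_[2]) =
      ((chiMinusFour 2 x : ℤ_[2]) : ℚ_[2]) * invUnitsDist klTwoDistribution m (x : ZMod (2 ^ m)) := by
  have hcop : Nat.Coprime x (2 ^ m) := (Nat.Coprime.pow_left _ (Nat.coprime_two_left.mpr hx)).symm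
  have hu : IsUnit ((x : ZMod (2 ^ m))) := (ZMod.isUnit_iff_coprime x _).mpr hcop
  rw [invUnitsDist, dif_pos hu, ← ZMod.inv_coe_unit, hu.unit_spec, klTwoDistribution_eq_of_two_le hm,
    chiMinusFour_inv_val hm hx, ← mul_assoc, ← PadicInt.coe_mul, chiMinusFour_mul_self_of_odd hx,
    PadicInt.coe_one, one_mul]

/-- **`E₁^{(2^m)}((AN)⁻¹) = χ₋₄(AN) · ([N]^*(χ₋₄E₁)ˇ)(A + 2^mℤ₂)`** for odd `A`, `N`, `m ≥ 2` (`codilate N` is the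
pull-back along multiplication by `N`): the level-`m` Bézout-junk function `A ↦ E₁((AN)⁻¹)` of the Eisenstein cusp
values in the tree's measure vocabulary; on the classes `A ≡ 1 (mod 4)` the twist is the constant `χ₋₄(N)`.
[cite: LangCyclotomic1990, Ch. 4 §2 (operations on measures, PDF pp. 80–82)] [cite: Stevens1982, §5.4 (PDF p. 73)] -/
theorem bernoulliDist_inv_mul_eq_chiMinusFour_mul_codilate {m : ℕ} (hm : 2 ≤ m) {A N : ℕ} (hA : Odd A) (hN : Odd N) :
    ((bernoulliDist 1 (2 ^ m) (((A * N : ℕ) : ZMod (2 ^ m)))⁻¹ : ℚ) : ℚ_[2]) =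
      ((chiMinusFour 2 (A * N) : ℤ_[2]) : ℚ_[2]) *
        codilate N (invUnitsDist klTwoDistribution) m (A : ZMod (2 ^ m)) := by
  rw [codilate_apply, ← Nat.cast_mul]
  exact bernoulliDist_inv_eq_chiMinusFour_mul_invUnitsDist hm (hA.mul hN)

end Literature.NumberTheory.EllipticCurves

end
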